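import Literature.NumberTheory.EllipticCurves.DeShalit1987.KatzMeasureUnitTwistPair
import Literature.NumberTheory.GaloisRepresentations.TateTwistFrobeniusProofs
import Literature.NumberTheory.GaloisRepresentations.ArtinCharacterReciprocity
import Literature.NumberTheory.GaloisRepresentations.CMTypeHeckeCharacter
import HarnessLib

/-!
# `p`-adic avatars multiply: the POINT TRANSPORT `ρ ↦ ηρ` on the two-variable Katz frame — the binder
# `hpt` of `IsKatzMeasure₂.unitTwist₂` / `isKatzBranch_unitTwist_lineSubst` DISCHARGED for a Hecke character `η`
# unramified away from `p` (all PROVED; no named fact)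

The frame lemmas `IsKatzMeasure₂.isKatzBranch_unitTwist_lineSubst` (`KatzMeasureTwistedLines.lean`, cell `bsd-eis`)
and `IsKatzMeasure₂.unitTwist₂` (`KatzMeasureUnitTwistPair.lean`, cell `bsd-print-cf2`) take the avatar bookkeeping
for the twisting character `η` as a hypothesis `hpt`: «every point `(ρ, r)` (`IsPAdicAvatarOf ι ρ r`, `r` through
the pair) is carried to a point `(ηρ, r')` with `r'(γᵢ) = uᵢ·r(γᵢ)`». This file proves it: if `e` is a `p`-adic
avatar of `η` (`IsPAdicAvatarOf ι η e`) and `η` is unramified at every finite place away from `p` (as is every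
character of the `ℤ_p²`-tower), then the TWIST `r ⊗ det e` (`FramedRep.twist`) is a `p`-adic avatar of `ηρ`
(`IsPAdicAvatarOf.mul_twist`: Serre's dictionary is multiplicative — the twist is unramified where both are,
`FramedGaloisRep.isUnramifiedAt_twist`, and its Frobenius value is the product,
`FramedGaloisRep.hasFrobCharpolyAt_twist_of_eq_prod`), it factors through the pair when `r` and `e` do, and
`(r ⊗ det e)(γ) = e(γ)·r(γ)` (`avatarValueAt_twist_detChar`). Hence `hpt` with `uᵢ = e(γᵢ)`
(`pointTransport_pair`), and the hypothesis-free frame translation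
`IsKatzMeasure₂.unitTwist₂_of_avatar`.

Cell `bsd-print-cf2`, width seat `bsd-line-cf2-p1-w5` g0, brick B1, crux `PrintCf2.SplitBadTwoRankOneOfFacts`
(stmt-BirchSwinnertonDyer-20368), road α, RULING (ac)(3). No named fact, no `sorry`, no `instance`, no notation.

## References

* [SerreAbelianLadic1968] J.-P. Serre, *Abelian ℓ-adic representations* (1968), Ch. I §2.1–2.3, Ch. II §2.7
  (the `ℓ`-adic avatar of a Hecke character; Frobenius values).
* [deShalit1987] E. de Shalit, *Iwasawa theory of elliptic curves with complex multiplication* (1987), II.1.1 (5)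
  (the `p`-adic avatar `ρ̂`), II.4.17 (52)–(54).
* [CastellaHsieh2018] F. Castella, M.-L. Hsieh, §3.3 (the avatar as a Galois character).
-/

noncomputable section

open Filter Topology Polynomial
open NumberField IsDedekindDomain Field
open Literature.NumberTheory.GaloisRepresentations

namespace Literature.NumberTheory.EllipticCurves

universe u

variable {p : ℕ} [Fact p.Prime]

/-! ### §1. The determinant character of a rank-one framed representation and the twist -/

section Det

variable {K : Type u} [Field K]

/-- **The character `det ∘ e : Γ_K →ₜ* ℚ̄_pˣ` of a rank-one framed `p`-adic representation `e`** (its only matrix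
entry, as a continuous character into the units). [cite: SerreAbelianLadic1968, Ch. I §1.1] -/
def detChar (e : FramedGaloisRep K (PadicAlgCl p) 1) : absoluteGaloisGroup K →ₜ* (PadicAlgCl p)ˣ where
  toMonoidHom := (Matrix.GeneralLinearGroup.det).comp e.toMonoidHom
  continuous_toFun := by
    have h1 : Continuous fun σ ↦ (e σ : GL (Fin 1) (PadicAlgCl p)) := map_continuous e
    have h2 : Continuous fun g : GL (Fin 1) (PadicAlgCl p) ↦ Matrix.GeneralLinearGroup.det g := by
      refine Units.continuous_iff.mpr ⟨?_, ?_⟩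
      · exact (Units.continuous_val.matrix_det).congr fun g ↦ by
          simp [Matrix.GeneralLinearGroup.val_det_apply]
      · have : Continuous fun g : GL (Fin 1) (PadicAlgCl p) ↦
            ((g⁻¹ : GL (Fin 1) (PadicAlgCl p)) : Matrix (Fin 1) (Fin 1) (PadicAlgCl p)).det :=
          (Units.continuous_val.comp continuous_inv).matrix_det
        refine this.congr fun g ↦ ?_
        rw [← Matrix.GeneralLinearGroup.val_det_apply, map_inv]
    exact h2.comp h1

/-- `det ∘ e` evaluated. [cite: SerreAbelianLadic1968, Ch. I §1.1] -/
@[simp] theorem detChar_apply (e : FramedGaloisRep K (PadicAlgCl p) 1) (σ : absoluteGaloisGroup K) :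
    detChar e σ = Matrix.GeneralLinearGroup.det (e σ) := rfl

/-- `r(σ)` in `ℂ_p` is the value of `det ∘ r`. [cite: CastellaHsieh2018, §3.3] -/
theorem avatarValueAt_eq_coe_detChar (r : FramedGaloisRep K (PadicAlgCl p) 1) (σ : absoluteGaloisGroup K) :
    avatarValueAt r σ = (((detChar r σ : (PadicAlgCl p)ˣ) : PadicAlgCl p) : ℂ_[p]) := rfl

/-- **`(r ⊗ χ)(σ) = χ(σ)·r(σ)` in `ℂ_p`** (`det (ρ ⊗ χ) = χ · det ρ` in rank one).
[cite: SerreAbelianLadic1968, Ch. I §2.3] -/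
theorem avatarValueAt_twist (r : FramedGaloisRep K (PadicAlgCl p) 1)
    (χ : absoluteGaloisGroup K →ₜ* (PadicAlgCl p)ˣ) (σ : absoluteGaloisGroup K) :
    avatarValueAt (FramedRep.twist r χ) σ = (((χ σ : (PadicAlgCl p)ˣ) : PadicAlgCl p) : ℂ_[p]) * avatarValueAt r σ := by
  rw [avatarValueAt, FramedRep.det_twist_apply, pow_one, Units.val_mul, avatarValueAt]
  push_cast
  rfl

/-- `(r ⊗ det e)(σ) = e(σ)·r(σ)`. [cite: SerreAbelianLadic1968, Ch. I §2.3] -/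
theorem avatarValueAt_twist_detChar (r e : FramedGaloisRep K (PadicAlgCl p) 1) (σ : absoluteGaloisGroup K) :
    avatarValueAt (FramedRep.twist r (detChar e)) σ = avatarValueAt e σ * avatarValueAt r σ := by
  rw [avatarValueAt_twist]
  rfl

/-- A rank-one framed representation with `e σ = 1` has `det e σ = 1`. [cite: SerreAbelianLadic1968, Ch. I §1.1] -/
theorem detChar_eq_one_of_apply_eq_one {e : FramedGaloisRep K (PadicAlgCl p) 1} {σ : absoluteGaloisGroup K}
    (h : e σ = 1) : detChar e σ = 1 := by
  rw [detChar_apply, h, map_one]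

/-- **The twist through the pair**: if `r` and `e` factor through `(κ₁, κ₂)` then so does `r ⊗ det e`.
[cite: deShalit1987, II.4.17 (54) (p. 78)] -/
theorem factorsThroughPair_twist_detChar {κ₁ κ₂ : ZpExtension K p} {r e : FramedGaloisRep K (PadicAlgCl p) 1}
    (hr : FactorsThroughPair κ₁ κ₂ r) (he : FactorsThroughPair κ₁ κ₂ e) :
    FactorsThroughPair κ₁ κ₂ (FramedRep.twist r (detChar e)) := by
  intro σ h₁ h₂
  rw [FramedRep.twist_apply_of_eq_one _ _ (detChar_eq_one_of_apply_eq_one (he σ h₁ h₂)), hr σ h₁ h₂]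

/-- The twist through a `ℤ_p`-line. [cite: deShalit1987, II.4.17 (52) (p. 77)] -/
theorem factorsThroughZp_twist_detChar {κ : ZpExtension K p} {r e : FramedGaloisRep K (PadicAlgCl p) 1}
    (hr : FactorsThroughZp κ r) (he : FactorsThroughZp κ e) :
    FactorsThroughZp κ (FramedRep.twist r (detChar e)) := by
  intro σ h
  rw [FramedRep.twist_apply_of_eq_one _ _ (detChar_eq_one_of_apply_eq_one (he σ h)), hr σ h]

end Det

/-! ### §2. Avatars multiply -/

section Avatar

variable {K : Type} [Field K] [NumberField K] {ι : PadicAlgCl p ≃+* ℂ}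

/-- `(χψ)(ϖ_v) = χ(ϖ_v) ψ(ϖ_v)`. [folklore] -/
private theorem valueAtUniformizer_mul' (χ ψ : HeckeCharacter K) (v : HeightOneSpectrum (𝓞 K)) :
    (χ * ψ).valueAtUniformizer v = χ.valueAtUniformizer v * ψ.valueAtUniformizer v := by
  simp only [HeckeCharacter.valueAtUniformizer, HeckeCharacter.localComponent_apply, HeckeCharacter.mul_apply,
    Units.val_mul]

omit [NumberField K] in
/-- The matrix entry of a rank-one framed representation is the value of its determinant character. [folklore] -/
private theorem entry_eq_coe_detChar (e : FramedGaloisRep K (PadicAlgCl p) 1) (σ : absoluteGaloisGroup K) :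
    ((e σ : GL (Fin 1) (PadicAlgCl p)) : Matrix (Fin 1) (Fin 1) (PadicAlgCl p)) 0 0 =
      ((detChar e σ : (PadicAlgCl p)ˣ) : PadicAlgCl p) := by
  rw [detChar_apply, Matrix.GeneralLinearGroup.val_det_apply, Matrix.det_fin_one]

/-- **`p`-ADIC AVATARS MULTIPLY (Serre's dictionary is a homomorphism): if `r` is an avatar of `ρ`, `e` an avatar of
`η`, and `η` is unramified at every finite place away from `p`, then `r ⊗ det e` is an avatar of `ηρ`.** At a place
`v ∤ p` where `ηρ` is unramified, `ρ = η⁻¹(ηρ)` is unramified too, so `r` and `e` are unramified at `v` with Frobenius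
values `ι⁻¹(ρ(ϖ_v))⁻¹`, `ι⁻¹(η(ϖ_v))⁻¹`; the twist is unramified at `v` (`FramedGaloisRep.isUnramifiedAt_twist`) with
Frobenius value the product (`hasFrobCharpolyAt_twist_of_eq_prod`), which is `ι⁻¹((ηρ)(ϖ_v))⁻¹`.
[cite: SerreAbelianLadic1968, Ch. I §2.3, Ch. II §2.7] [cite: CastellaHsieh2018, §3.3] -/
theorem IsPAdicAvatarOf.mul_twist {ρ η : HeckeCharacter K} {r e : FramedGaloisRep K (PadicAlgCl p) 1}
    (hr : IsPAdicAvatarOf ι ρ r) (he : IsPAdicAvatarOf ι η e)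
    (hη : ∀ v : HeightOneSpectrum (𝓞 K), ((p : ℕ) : 𝓞 K) ∉ v.asIdeal → η.IsUnramifiedAt v) :
    IsPAdicAvatarOf ι (η * ρ) (FramedRep.twist r (detChar e)) := by
  intro v hv hunr
  have hηv := hη v hv
  have hρv : ρ.IsUnramifiedAt v := by
    have h := hηv.inv'.mul' hunr
    rwa [inv_mul_cancel_left] at h
  obtain ⟨hr₁, hr₂⟩ := hr v hv hρv
  obtain ⟨he₁, he₂⟩ := he v hv hηv
  refine ⟨FramedGaloisRep.isUnramifiedAt_twist hr₁ fun 𝔓 h𝔓 σ hσ ↦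
    detChar_eq_one_of_apply_eq_one (he₁ 𝔓 h𝔓 σ hσ), ?_⟩
  -- Frobenius values
  set a : PadicAlgCl p := (ι.symm (ρ.valueAtUniformizer v))⁻¹ with ha
  set b : PadicAlgCl p := (ι.symm (η.valueAtUniformizer v))⁻¹ with hb
  have hr₂' : FramedGaloisRep.HasFrobCharpolyAt v ((({a} : Multiset (PadicAlgCl p)).map fun x ↦ X - C x).prod) r := by
    simpa using hr₂
  have heb : ∀ 𝔓 ∈ v.primesAbove, ∀ σ : absoluteGaloisGroup K, IsArithFrobAt (𝓞 K) σ 𝔓 →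
      ((detChar e σ : (PadicAlgCl p)ˣ) : PadicAlgCl p) = b := by
    intro 𝔓 h𝔓 σ hσ
    rw [← entry_eq_coe_detChar]
    exact (FramedGaloisRep.hasFrobCharpolyAt_iff_of_rank_one e v b).mp he₂ 𝔓 h𝔓 σ hσ
  have key := FramedGaloisRep.hasFrobCharpolyAt_twist_of_eq_prod hr₂' heb
  have hval : (ι.symm ((η * ρ).valueAtUniformizer v))⁻¹ = b * a := by
    rw [valueAtUniformizer_mul', map_mul, mul_inv, hb, ha]
  rw [hval]
  simpa using key

end Avatar

/-! ### §3. The point transport and the hypothesis-free frame translation -/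

section Frame

variable {K : Type} [Field K] [NumberField K]
  {ι : PadicAlgCl p ≃+* ℂ} {v vbar : HeightOneSpectrum (𝓞 K)} {S : Finset (HeightOneSpectrum (𝓞 K))}
  {κ κ₁ κ₂ : ZpExtension K p} {γ γ₁ γ₂ : absoluteGaloisGroup K}
  {lam η : HeckeCharacter K} {Ω δ : ℂ} {Ωp : ℂ_[p]} {e : FramedGaloisRep K (PadicAlgCl p) 1}

/-- **THE POINT TRANSPORT `hpt` for the pair**: if `e` is a `p`-adic avatar of `η` through the pair and `η` is
unramified away from `p`, every point `(ρ, r)` of the pair is carried to the point `(ηρ, r ⊗ det e)` with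
`(r ⊗ det e)(γᵢ) = e(γᵢ)·r(γᵢ)` — for ANY `γ₁, γ₂` (`pointTransport_pair`). [cite: deShalit1987, II.4.17 (54) (p. 78)]
[cite: SerreAbelianLadic1968, Ch. II §2.7] -/
theorem pointTransport_pair (he : IsPAdicAvatarOf ι η e) (heκ : FactorsThroughPair κ₁ κ₂ e)
    (hη : ∀ w : HeightOneSpectrum (𝓞 K), ((p : ℕ) : 𝓞 K) ∉ w.asIdeal → η.IsUnramifiedAt w)
    (ρ : HeckeCharacter K) (r : FramedGaloisRep K (PadicAlgCl p) 1)
    (hr : IsPAdicAvatarOf ι ρ r) (hrκ : FactorsThroughPair κ₁ κ₂ r) :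
    ∃ r' : FramedGaloisRep K (PadicAlgCl p) 1,
      IsPAdicAvatarOf ι (η * ρ) r' ∧ FactorsThroughPair κ₁ κ₂ r' ∧
        avatarValueAt r' γ₁ = avatarValueAt e γ₁ * avatarValueAt r γ₁ ∧
        avatarValueAt r' γ₂ = avatarValueAt e γ₂ * avatarValueAt r γ₂ :=
  ⟨FramedRep.twist r (detChar e), hr.mul_twist he hη, factorsThroughPair_twist_detChar hrκ heκ,
    avatarValueAt_twist_detChar r e γ₁, avatarValueAt_twist_detChar r e γ₂⟩

/-- `e(γ)` lies in `𝒪_{ℂ_p}` (a value of a continuous character of the compact `Γ_K`). [cite: CastellaHsieh2018, §3.3] -/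
theorem avatarValueAt_mem_padicComplexInt (r : FramedGaloisRep K (PadicAlgCl p) 1) (σ : absoluteGaloisGroup K) :
    avatarValueAt r σ ∈ PadicComplexInt p :=
  mem_padicComplexInt_iff.mpr (norm_avatarValueAt_eq_one r σ).le

/-- **THE FINITE-TWIST TRANSLATION WITHOUT `hpt`**: if `G` is the `λ`-branch of the two-variable Katz–de Shalit measure
for `(κ₁, κ₂; γ₁, γ₂)` and `e` is a `p`-adic avatar through the pair of a Hecke character `η` unramified away from `p`,
then `unitTwist₂ G e(γ₁) e(γ₂)` (the substitution `Tᵢ ↦ e(γᵢ)(1+Tᵢ) − 1`) is the `λη`-branch for the same pair.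
[cite: deShalit1987, II.4.17 (52)–(54) (p. 77–78)] [cite: SerreAbelianLadic1968, Ch. II §2.7] -/
theorem IsKatzMeasure₂.unitTwist₂_of_avatar {G : PowerSeries (PowerSeries (PadicComplexInt p))}
    (hG : IsKatzMeasure₂ ι v vbar S κ₁ κ₂ γ₁ γ₂ lam Ω δ Ωp G) (he : IsPAdicAvatarOf ι η e)
    (heκ : FactorsThroughPair κ₁ κ₂ e)
    (hη : ∀ w : HeightOneSpectrum (𝓞 K), ((p : ℕ) : 𝓞 K) ∉ w.asIdeal → η.IsUnramifiedAt w) :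
    IsKatzMeasure₂ ι v vbar S κ₁ κ₂ γ₁ γ₂ (lam * η) Ω δ Ωp
      (IntSeries.unitTwist₂ G ⟨avatarValueAt e γ₁, avatarValueAt_mem_padicComplexInt e γ₁⟩
        ⟨avatarValueAt e γ₂, avatarValueAt_mem_padicComplexInt e γ₂⟩) :=
  hG.unitTwist₂ (norm_avatarValueAt_sub_one_lt_of_factorsThroughPair heκ γ₁)
    (norm_avatarValueAt_sub_one_lt_of_factorsThroughPair heκ γ₂) (pointTransport_pair he heκ hη)

/-- **One variable, without `hpt`**: the `κ`-branch of `λη` is the unit twist by `e(γ)` of the `κ`-branch of `λ`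
for `e` an avatar of `η` through `κ`, `η` unramified away from `p`. [cite: deShalit1987, II.4.17 (52) (p. 77)] -/
theorem DeShalit1987.IsKatzBranch.unitTwist_of_avatar {Q : PowerSeries (PadicComplexInt p)}
    (hQ : DeShalit1987.IsKatzBranch ι v vbar S κ γ lam Ω δ Ωp Q) (hγ : κ.IsTopGenerator γ)
    (he : IsPAdicAvatarOf ι η e) (heκ : FactorsThroughZp κ e)
    (hη : ∀ w : HeightOneSpectrum (𝓞 K), ((p : ℕ) : 𝓞 K) ∉ w.asIdeal → η.IsUnramifiedAt w) :
    DeShalit1987.IsKatzBranch ι v vbar S κ γ (lam * η) Ω δ Ωp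
      (IntSeries.unitTwist Q ⟨avatarValueAt e γ, avatarValueAt_mem_padicComplexInt e γ⟩) :=
  hQ.unitTwist hγ (ZpExtension.norm_avatarValueAt_sub_one_lt heκ hγ) fun _ r hr hrκ ↦
    ⟨FramedRep.twist r (detChar e), hr.mul_twist he hη, factorsThroughZp_twist_detChar hrκ heκ,
      avatarValueAt_twist_detChar r e γ⟩

end Frame

end Literature.NumberTheory.EllipticCurves

end
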